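import Summits.AtomisticToContinuum.Crystallization.Theorems.MinimisingLawsHaveAtoms.Negative.DilationFamily
import Summits.AtomisticToContinuum.Crystallization.Theorems.MinimisingLawsHaveAtoms.Negative.MeckeCovariance
import Summits.AtomisticToContinuum.Crystallization.Theorems.PalmUnimodularRigidityBenjaminiSchrammLimitCampbell

/-!
# Negative knowledge for crux `MinimisingLawsHaveAtoms` (stmt-AtomisticToContinuum-15776), IX:
# the randomly dilated law — pull-back to the configuration space, probability, hard core, and
# the MECKE IDENTITY

Standing crux disprover `cdisprove-stmt-AtomisticToContinuum-15776`,
`--supports stmt-AtomisticToContinuum-15776`; fourth piece of the threshold-sharpness programme.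

Given a law `Q` on `RootedHardCoreConfig ℝ³ δ` and a parameter law `ν` on `ℝ`, the RANDOMLY DILATED
LAW is the push-forward of `ν ⊗ Q` along `(c, S) ↦ count|((max c 1) • S)` (the landed jointly
continuous dilation `DilationFamily.continuous_dilate` followed by the landed measurable embedding
`S ↦ count|S`).
* `map_comap_toMeasure`, `isProbabilityMeasure_comap_toMeasure` — every a.s. `δ`-hard-core law `P`
  on `Measure ℝ³` IS such a push-forward: `P = (P.comap (S ↦ count|S)).map (S ↦ count|S)`, so the
  abstract minimising law of the crux's frame can be dilated;
* `measurable_lintegral_toMeasure`, `measurable_lintegral_shift_toMeasure` — both sides of the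
  Mecke identity, read on the configuration space, are Borel (s-finite counting kernel, re-rooting
  involution; the pattern of `BenjaminiSchrammLimit.isPointStationaryLaw_map_toMeasure`);
* `isPointStationaryLaw_dilatedLaw` — **the randomly dilated law of a point-stationary law is
  point-stationary** (Tonelli over `c`, then for each `c` the landed covariance
  `IsPointStationaryLaw.map_mapSmul`); `ae_isRootedHardCore_dilatedLaw`,
  `isProbabilityMeasure_dilatedLaw`.
What remains for threshold sharpness: the energy moves by `O(E_ν[c − 1])` (Part X) and the dilated
law charges no rooted class when `ν` is atomless (Part XI).  All `[folklore]`.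
-/

noncomputable section

namespace Summit.AtomisticToContinuum.Crystallization.Theorems.MinimisingLawsHaveAtoms.Negative.DilatedLawMecke

open MeasureTheory Set Filter Function ProbabilityTheory
open scoped ENNReal Topology Classical
open Literature.MathematicalPhysics.StatisticalMechanics Literature.Probability.Process
open Literature.Probability.Process.LocalConfig
open Summit.AtomisticToContinuum.Crystallization.Theorems.BenjaminiSchrammLimit
  (measurableEmbedding_toMeasure isSFiniteKernel_toMeasure measurable_reroot)
open Summit.AtomisticToContinuum.Crystallization.Theorems.MinimisingLawsHaveAtoms.Negative.DilationFamily

variable {δ : ℝ} [Fact (0 < δ)]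

/-! ## §1 Every a.s. hard-core law lives on the configuration space -/

omit [Fact (0 < δ)] in
/-- The range of `S ↦ count|S` on rooted `δ`-hard-core configurations is the set of rooted
`δ`-hard-core counting measures. [folklore] -/
theorem range_toMeasure :
    Set.range (fun S : RootedHardCoreConfig (EuclideanSpace ℝ (Fin 3)) δ =>
      (S.1 : LocalConfig (EuclideanSpace ℝ (Fin 3))).toMeasure) =
      {μ : Measure (EuclideanSpace ℝ (Fin 3)) | IsRootedHardCore δ μ} := by
  ext μ
  constructor
  · rintro ⟨S, rfl⟩
    exact (isRootedHardCore_toMeasure_iff δ _).2 S.2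
  · rintro ⟨T, h0, hsep, rfl⟩
    exact ⟨⟨LocalConfig.mk T, h0, hsep⟩, rfl⟩

/-- **An a.s. `δ`-hard-core law is the push-forward of its pull-back to the configuration space.**
[folklore] -/
theorem map_comap_toMeasure {P : Measure (Measure (EuclideanSpace ℝ (Fin 3)))}
    (hhc : ∀ᵐ μ ∂P, IsRootedHardCore δ μ) :
    (P.comap fun S : RootedHardCoreConfig (EuclideanSpace ℝ (Fin 3)) δ =>
        (S.1 : LocalConfig (EuclideanSpace ℝ (Fin 3))).toMeasure).map
      (fun S : RootedHardCoreConfig (EuclideanSpace ℝ (Fin 3)) δ =>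
        (S.1 : LocalConfig (EuclideanSpace ℝ (Fin 3))).toMeasure) = P := by
  rw [(measurableEmbedding_toMeasure (EuclideanSpace ℝ (Fin 3)) (δ := δ)).map_comap, range_toMeasure]
  exact Measure.restrict_eq_self_of_ae_mem hhc

/-- The pull-back of an a.s. `δ`-hard-core probability law is a probability law. [folklore] -/
theorem isProbabilityMeasure_comap_toMeasure {P : Measure (Measure (EuclideanSpace ℝ (Fin 3)))}
    [IsProbabilityMeasure P] (hhc : ∀ᵐ μ ∂P, IsRootedHardCore δ μ) :
    IsProbabilityMeasure (P.comap fun S : RootedHardCoreConfig (EuclideanSpace ℝ (Fin 3)) δ =>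
      (S.1 : LocalConfig (EuclideanSpace ℝ (Fin 3))).toMeasure) := by
  have h := map_comap_toMeasure hhc
  refine ⟨?_⟩
  have := congrArg (fun R : Measure (Measure (EuclideanSpace ℝ (Fin 3))) => R univ) h
  simp only [measure_univ] at this
  rwa [(measurableEmbedding_toMeasure (EuclideanSpace ℝ (Fin 3)) (δ := δ)).map_apply,
    preimage_univ] at this

/-! ## §2 The two sides of the Mecke identity are Borel on the configuration space -/

/-- The left side `S ↦ ∫ g(count|S, y) d(count|S)(y)` is Borel (s-finite counting kernel).
[folklore] -/
theorem measurable_lintegral_toMeasure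
    {g : Measure (EuclideanSpace ℝ (Fin 3)) → EuclideanSpace ℝ (Fin 3) → ℝ≥0∞}
    (hg : Measurable (uncurry g)) :
    Measurable fun S : RootedHardCoreConfig (EuclideanSpace ℝ (Fin 3)) δ =>
      ∫⁻ y, g ((S.1 : LocalConfig (EuclideanSpace ℝ (Fin 3))).toMeasure) y
        ∂((S.1 : LocalConfig (EuclideanSpace ℝ (Fin 3))).toMeasure) := by
  have hδ : 0 < δ := Fact.out
  haveI : IsSFiniteKernel (⟨fun S : RootedHardCoreConfig (EuclideanSpace ℝ (Fin 3)) δ =>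
      (S.1 : LocalConfig (EuclideanSpace ℝ (Fin 3))).toMeasure, measurable_toMeasure
        (Fact.out : 0 < δ)⟩ : Kernel (RootedHardCoreConfig (EuclideanSpace ℝ (Fin 3)) δ)
          (EuclideanSpace ℝ (Fin 3))) := isSFiniteKernel_toMeasure
  have hG : Measurable (uncurry fun (S : RootedHardCoreConfig (EuclideanSpace ℝ (Fin 3)) δ)
      (y : EuclideanSpace ℝ (Fin 3)) => g ((S.1 : LocalConfig (EuclideanSpace ℝ (Fin 3))).toMeasure) y) :=
    hg.comp ((measurable_toMeasure hδ).prodMap measurable_id)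
  exact hG.lintegral_kernel_prod_right
    (κ := (⟨fun S : RootedHardCoreConfig (EuclideanSpace ℝ (Fin 3)) δ =>
      (S.1 : LocalConfig (EuclideanSpace ℝ (Fin 3))).toMeasure, measurable_toMeasure
        (Fact.out : 0 < δ)⟩ : Kernel (RootedHardCoreConfig (EuclideanSpace ℝ (Fin 3)) δ)
          (EuclideanSpace ℝ (Fin 3))))

/-- The right side `S ↦ ∫ g(θ_y count|S, −y) d(count|S)(y)` is Borel (re-rooting involution on
the incidence set, `measurable_reroot`). [folklore] -/
theorem measurable_lintegral_shift_toMeasure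
    {g : Measure (EuclideanSpace ℝ (Fin 3)) → EuclideanSpace ℝ (Fin 3) → ℝ≥0∞}
    (hg : Measurable (uncurry g)) :
    Measurable fun S : RootedHardCoreConfig (EuclideanSpace ℝ (Fin 3)) δ =>
      ∫⁻ y, g (((S.1 : LocalConfig (EuclideanSpace ℝ (Fin 3))).toMeasure).map fun z => z - y) (-y)
        ∂((S.1 : LocalConfig (EuclideanSpace ℝ (Fin 3))).toMeasure) := by
  have hδ : 0 < δ := Fact.out
  haveI : IsSFiniteKernel (⟨fun S : RootedHardCoreConfig (EuclideanSpace ℝ (Fin 3)) δ =>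
      (S.1 : LocalConfig (EuclideanSpace ℝ (Fin 3))).toMeasure, measurable_toMeasure
        (Fact.out : 0 < δ)⟩ : Kernel (RootedHardCoreConfig (EuclideanSpace ℝ (Fin 3)) δ)
          (EuclideanSpace ℝ (Fin 3))) := isSFiniteKernel_toMeasure
  set Θ : RootedHardCoreConfig (EuclideanSpace ℝ (Fin 3)) δ × EuclideanSpace ℝ (Fin 3) →
      RootedHardCoreConfig (EuclideanSpace ℝ (Fin 3)) δ × EuclideanSpace ℝ (Fin 3) :=
    fun p => ((if h : p.2 ∈ ((p.1.1 : LocalConfig (EuclideanSpace ℝ (Fin 3))) :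
        Set (EuclideanSpace ℝ (Fin 3))) then p.1.reroot p.2 h else p.1 :
          RootedHardCoreConfig (EuclideanSpace ℝ (Fin 3)) δ), -p.2) with hΘdef
  have hΘ : Measurable Θ := measurable_reroot hδ
  set G : RootedHardCoreConfig (EuclideanSpace ℝ (Fin 3)) δ × EuclideanSpace ℝ (Fin 3) → ℝ≥0∞ :=
    fun p => g ((p.1.1 : LocalConfig (EuclideanSpace ℝ (Fin 3))).toMeasure) p.2 with hGdef
  have hG : Measurable G := hg.comp ((measurable_toMeasure hδ).prodMap measurable_id)
  set F' : RootedHardCoreConfig (EuclideanSpace ℝ (Fin 3)) δ → EuclideanSpace ℝ (Fin 3) → ℝ≥0∞ :=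
    fun S y => G (Θ (S, y)) with hF'def
  have hF' : Measurable (uncurry F') := hG.comp hΘ
  have key : (fun S : RootedHardCoreConfig (EuclideanSpace ℝ (Fin 3)) δ =>
      ∫⁻ y, g (((S.1 : LocalConfig (EuclideanSpace ℝ (Fin 3))).toMeasure).map fun z => z - y) (-y)
        ∂((S.1 : LocalConfig (EuclideanSpace ℝ (Fin 3))).toMeasure)) =
      fun S => ∫⁻ y, F' S y ∂((S.1 : LocalConfig (EuclideanSpace ℝ (Fin 3))).toMeasure) := by
    funext S
    rw [toMeasure_def]
    refine setLIntegral_congr_fun (RootedHardCoreConfig.isClosed_coe hδ S).measurableSet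
      fun y hy => ?_
    simp only [hF'def, hGdef, hΘdef, dif_pos hy]
    rw [RootedHardCoreConfig.toMeasure_reroot, toMeasure_def]
  rw [key]
  exact hF'.lintegral_kernel_prod_right
    (κ := (⟨fun S : RootedHardCoreConfig (EuclideanSpace ℝ (Fin 3)) δ =>
      (S.1 : LocalConfig (EuclideanSpace ℝ (Fin 3))).toMeasure, measurable_toMeasure
        (Fact.out : 0 < δ)⟩ : Kernel (RootedHardCoreConfig (EuclideanSpace ℝ (Fin 3)) δ)
          (EuclideanSpace ℝ (Fin 3))))

/-! ## §3 The randomly dilated law -/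

omit [Fact (0 < δ)] in
/-- Integration against the law dilated by a fixed factor `a ≠ 0` (a measurable automorphism of
`Measure ℝ³`): `∫ G d((a•·)_*)_* P = ∫ G((a•·)_* μ) dP(μ)` for every `G`. [folklore] -/
theorem lintegral_map_mapSmul (P : Measure (Measure (EuclideanSpace ℝ (Fin 3)))) {a : ℝ}
    (ha : a ≠ 0) (G : Measure (EuclideanSpace ℝ (Fin 3)) → ℝ≥0∞) :
    ∫⁻ μ, G μ ∂(P.map fun μ : Measure (EuclideanSpace ℝ (Fin 3)) =>
        μ.map fun x : EuclideanSpace ℝ (Fin 3) => a • x) =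
      ∫⁻ μ, G (μ.map fun x : EuclideanSpace ℝ (Fin 3) => a • x) ∂P := by
  have hm : Measurable fun x : EuclideanSpace ℝ (Fin 3) => a • x := measurable_const_smul a
  have hmi : Measurable fun x : EuclideanSpace ℝ (Fin 3) => a⁻¹ • x := measurable_const_smul a⁻¹
  have hcomp1 : (fun x : EuclideanSpace ℝ (Fin 3) => a⁻¹ • x) ∘ (fun x => a • x) = id :=
    funext fun x => by simp [smul_smul, inv_mul_cancel₀ ha]
  have hcomp2 : (fun x : EuclideanSpace ℝ (Fin 3) => a • x) ∘ (fun x => a⁻¹ • x) = id :=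
    funext fun x => by simp [smul_smul, mul_inv_cancel₀ ha]
  set E : Measure (EuclideanSpace ℝ (Fin 3)) ≃ᵐ Measure (EuclideanSpace ℝ (Fin 3)) :=
    { toFun := fun μ => μ.map fun x => a • x
      invFun := fun μ => μ.map fun x => a⁻¹ • x
      left_inv := fun μ => by
        change (μ.map fun x => a • x).map (fun x => a⁻¹ • x) = μ
        rw [Measure.map_map hmi hm, hcomp1, Measure.map_id]
      right_inv := fun μ => by
        change (μ.map fun x => a⁻¹ • x).map (fun x => a • x) = μ
        rw [Measure.map_map hm hmi, hcomp2, Measure.map_id]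
      measurable_toFun := MeckeCovariance.measurable_map_of_measurable hm
      measurable_invFun := MeckeCovariance.measurable_map_of_measurable hmi } with hE
  exact lintegral_map_equiv G E

/-- **The randomly dilated law is point-stationary.** For a law `Q` on rooted `δ`-hard-core
configurations whose push-forward `Q ∘ (S ↦ count|S)⁻¹` is point-stationary and any s-finite
parameter law `ν` on `ℝ`, the push-forward of `ν ⊗ Q` along `(c, S) ↦ count|((max c 1) • S)`
satisfies the Mecke identity. [folklore] -/
theorem isPointStationaryLaw_dilatedLaw
    (Q : Measure (RootedHardCoreConfig (EuclideanSpace ℝ (Fin 3)) δ)) [SFinite Q]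
    (ν : Measure ℝ) [SFinite ν]
    (hQ : IsPointStationaryLaw (Q.map fun S : RootedHardCoreConfig (EuclideanSpace ℝ (Fin 3)) δ =>
      (S.1 : LocalConfig (EuclideanSpace ℝ (Fin 3))).toMeasure)) :
    IsPointStationaryLaw (((ν.prod Q).map fun p : ℝ × RootedHardCoreConfig (EuclideanSpace ℝ (Fin 3)) δ =>
      (⟨LocalConfig.mk ((fun x : EuclideanSpace ℝ (Fin 3) => max p.1 1 • x) ''
          ((p.2.1 : LocalConfig (EuclideanSpace ℝ (Fin 3))) : Set (EuclideanSpace ℝ (Fin 3)))),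
        smul_image_rooted_separated (le_max_right _ _) p.2.2.1 p.2.2.2⟩ :
          RootedHardCoreConfig (EuclideanSpace ℝ (Fin 3)) δ)).map
      fun S : RootedHardCoreConfig (EuclideanSpace ℝ (Fin 3)) δ =>
        (S.1 : LocalConfig (EuclideanSpace ℝ (Fin 3))).toMeasure) := by
  have hE := measurableEmbedding_toMeasure (EuclideanSpace ℝ (Fin 3)) (δ := δ)
  have hΨ := measurable_dilate (δ := δ)
  intro g hg
  have hm1 := measurable_lintegral_toMeasure (δ := δ) hg
  have hm2 := measurable_lintegral_shift_toMeasure (δ := δ) hg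
  rw [hE.lintegral_map, hE.lintegral_map, lintegral_map hm1 hΨ, lintegral_map hm2 hΨ]
  refine ((lintegral_prod _ (hm1.comp hΨ).aemeasurable).trans ?_).trans
    (lintegral_prod _ (hm2.comp hΨ).aemeasurable).symm
  refine lintegral_congr fun c => ?_
  have ha : max c 1 ≠ 0 := by positivity
  simp only [comp_apply, toMeasure_dilate]
  rw [← hE.lintegral_map (μ := Q) (fun μ => ∫⁻ y, g (μ.map fun x : EuclideanSpace ℝ (Fin 3) =>
      max c 1 • x) y ∂(μ.map fun x : EuclideanSpace ℝ (Fin 3) => max c 1 • x)),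
    ← hE.lintegral_map (μ := Q) (fun μ => ∫⁻ y, g ((μ.map fun x : EuclideanSpace ℝ (Fin 3) =>
      max c 1 • x).map fun z => z - y) (-y) ∂(μ.map fun x : EuclideanSpace ℝ (Fin 3) => max c 1 • x)),
    ← lintegral_map_mapSmul _ ha (fun μ => ∫⁻ y, g μ y ∂μ),
    ← lintegral_map_mapSmul _ ha (fun μ => ∫⁻ y, g (μ.map fun z => z - y) (-y) ∂μ)]
  exact (hQ.map_mapSmul ha) g hg

/-- **The randomly dilated law is a.s. `δ`-hard-core.** [folklore] -/
theorem ae_isRootedHardCore_dilatedLaw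
    (Q : Measure (RootedHardCoreConfig (EuclideanSpace ℝ (Fin 3)) δ)) (ν : Measure ℝ) :
    ∀ᵐ μ ∂(((ν.prod Q).map fun p : ℝ × RootedHardCoreConfig (EuclideanSpace ℝ (Fin 3)) δ =>
      (⟨LocalConfig.mk ((fun x : EuclideanSpace ℝ (Fin 3) => max p.1 1 • x) ''
          ((p.2.1 : LocalConfig (EuclideanSpace ℝ (Fin 3))) : Set (EuclideanSpace ℝ (Fin 3)))),
        smul_image_rooted_separated (le_max_right _ _) p.2.2.1 p.2.2.2⟩ :
          RootedHardCoreConfig (EuclideanSpace ℝ (Fin 3)) δ)).map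
      fun S : RootedHardCoreConfig (EuclideanSpace ℝ (Fin 3)) δ =>
        (S.1 : LocalConfig (EuclideanSpace ℝ (Fin 3))).toMeasure), IsRootedHardCore δ μ :=
  (measurableEmbedding_toMeasure (EuclideanSpace ℝ (Fin 3)) (δ := δ)).ae_map_iff.2
    (Eventually.of_forall fun S => (isRootedHardCore_toMeasure_iff δ _).2 S.2)

/-- **The randomly dilated law of probability laws is a probability law.** [folklore] -/
theorem isProbabilityMeasure_dilatedLaw
    (Q : Measure (RootedHardCoreConfig (EuclideanSpace ℝ (Fin 3)) δ)) [IsProbabilityMeasure Q]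
    (ν : Measure ℝ) [IsProbabilityMeasure ν] :
    IsProbabilityMeasure (((ν.prod Q).map fun p : ℝ × RootedHardCoreConfig (EuclideanSpace ℝ (Fin 3)) δ =>
      (⟨LocalConfig.mk ((fun x : EuclideanSpace ℝ (Fin 3) => max p.1 1 • x) ''
          ((p.2.1 : LocalConfig (EuclideanSpace ℝ (Fin 3))) : Set (EuclideanSpace ℝ (Fin 3)))),
        smul_image_rooted_separated (le_max_right _ _) p.2.2.1 p.2.2.2⟩ :
          RootedHardCoreConfig (EuclideanSpace ℝ (Fin 3)) δ)).map
      fun S : RootedHardCoreConfig (EuclideanSpace ℝ (Fin 3)) δ =>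
        (S.1 : LocalConfig (EuclideanSpace ℝ (Fin 3))).toMeasure) :=
  haveI := Measure.isProbabilityMeasure_map (μ := ν.prod Q) (measurable_dilate (δ := δ)).aemeasurable
  Measure.isProbabilityMeasure_map
    (measurableEmbedding_toMeasure (EuclideanSpace ℝ (Fin 3)) (δ := δ)).measurable.aemeasurable

end Summit.AtomisticToContinuum.Crystallization.Theorems.MinimisingLawsHaveAtoms.Negative.DilatedLawMecke

end
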